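import Mathlib.Analysis.SpecialFunctions.Log.Deriv
import Literature.Analysis.FluidPDE.RescaledEulerLeray
import Literature.Analysis.FluidPDE.LeraySelfSimilarCalculus
import Literature.Analysis.FluidPDE.SpaceTimeCalculus
import HarnessLib

/-!
# Backward (ancient) similarity variables `y = x/√(−t)`, `s = −log(−t)` for Navier–Stokes on `(−∞, 0) × E`:
  the dictionary

Analysis/FluidPDE definition file (request `defn-ancientSimPull` of route `CorkscrewDynamo`, also
serving `DssFarFieldSlaving`): the twin, for fields living on the *past* `(−∞, 0) × E`, of the
forward similarity variables of `SimilarityVariables.lean` (`t = e^{2s}/2 > 0`). A velocity field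
`u(t, x)` on `(−∞, 0) × E` is read in the **backward similarity variables**

  `U(s, y) = √(−t) u(t, x)`,  `t = −e^{−s}`,  `x = √(−t) y = e^{−s/2} y`,  `s = −log(−t)`.

The velocity transform `U = lerayOrbit u`, `lerayOrbit u s y = e^{−s/2} • u (−e^{−s}) (e^{−s/2} • y)`,
is already in the tree (`HyperbolicDSSOrbit.lean`; it is *letter for letter* the requested
`ancientSimPull u`, which is therefore not redeclared), together with the pressure transform
`lerayOrbitPressure` (weight `−t = e^{−s}`) and the inverse transforms `ofLerayOrbit`,
`ofLerayOrbitPressure` (profile ↦ physical field, `u(t, x) = (−t)^{−1/2} U(−log(−t), (−t)^{−1/2} x)`;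
`RescaledEulerLeray.lean`) — all reused. This file adds the rest of the change of variables and its
dictionary: the time and space–time maps (`ancientSimTime`, `ancientSimTimeInv`, `ancientSimMap`,
`ancientSimInv`), the transform `lerayOrbitForce` of forces / equation terms (weight
`(−t)^{3/2} = e^{−3s/2}`), the inverse transforms as identities of fields (on an `s`-independent
profile they are Leray's backward ansatz `lerayBackward (1/2) 0`, `lerayBackwardPressure (1/2) 0`
of `SelfSimilar.lean`, rate `a = ½`, blow-up time `T = 0`), the chain rules, the backward Leray
system with viscosity `ν`, `IsBackwardLeraySolutionOn` (an abbreviation of classical Navier–Stokes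
with Leray's drift force; for `ν = 1` definitionally the tree's `IsRescaledEulerLeraySolutionOn S 1`
of route `EulerMelnikovDss`), its equivalence with Navier–Stokes on the past, and the symmetry
dictionary (scaling, (rotated) discrete self-similarity, Type I bounds).

This is the change of variables of Chae–Wolf 2017 (removing discretely self-similar
singularities), §4: "`u(x,t) = (t_* − t)^{−1/2} U(y, s)`, `π(x,t) = (t_* − t)^{−1} P(y, s)`,
`y = (x − x_*)/√(t_* − t)`, `s = −log(t_* − t)`" with `(x_*, t_*) = (0, 0)`, under which
"`(U, P)` solves `U_s + ½U + ½(y·∇)U + (U·∇)U − ΔU = −∇P`, `∇·U = 0`" and "the discrete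
self-similarity `λu(λx, λ²t) = u(x, t)` is equivalent to the time periodicity
`U(·, s) = U(·, s + S₀)`, `S₀ := 2 log λ`" (ibid.); the steady case is Leray 1934, (3.11)–(3.12)
(Nečas–Růžička–Šverák 1996, (1.3)–(1.5); Lemarié-Rieusset 2016, §16.4:
"`u(t,x) = |t|^{−1/2} U(x/√|t|)` with `U(x) = u(−1, x)`").

## Contents

* `ancientSimTime s = −e^{−s}`, `ancientSimTimeInv t = −log(−t)`, `ancientSimMap`, `ancientSimInv`:
  inversion formulas, smoothness, ranges, images of time sets.
* `lerayOrbitForce` (physical → similarity, next to the tree's `lerayOrbit`, `lerayOrbitPressure`);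
  the tree's `ofLerayOrbit`, `ofLerayOrbitPressure` (similarity → physical) as identities of fields:
  `orbit ∘ inv = id`, `inv ∘ orbit = id` on `t < 0`; `ofLerayOrbit` of a steady profile is
  `lerayBackward (1/2) 0`.
* **Dictionary (chain rules)** for `U = lerayOrbit u`, `P = lerayOrbitPressure p` at
  `(t, x) = (−e^{−s}, e^{−s/2} y)`: `D_yU = e^{−s} D_xu`, `div U = e^{−s} div u`,
  `(U·∇)U = e^{−3s/2} (u·∇)u`, `ΔU = e^{−3s/2} Δu`, `∇P = e^{−3s/2} ∇p`, and
  `∂ₛU + ½U + ½(y·∇)U = e^{−3s/2} ∂ₜu`.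
* `IsBackwardLeraySolutionOn S ν U P`: classical solutions of the **backward Leray system**
  `∂ₛU + ½U + ½(y·∇)U + (U·∇)U + ∇P = νΔU`, `div U = 0` on a time set `S` (in `s`), and
  **the equivalence** with classical Navier–Stokes solutions (`ν`, zero force) on open time sets
  `T ⊆ (−∞, 0)`: `isClassicalNSSolutionOn_iff_isBackwardLeraySolutionOn_lerayOrbit`,
  `isClassicalNSSolutionOn_ofLerayOrbit_iff`; the steady case is `IsLerayProfile ν (1/2)`.
* **Symmetry dictionary**: `nsRescale λ` acts on profiles as the time shift `s ↦ s − 2 log λ`;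
  `λ`-DSS ⇒ `U` is `2 log λ`-periodic (and conversely on `t < 0`); rotated DSS ⇔ the twisted
  periodicity `U(s + 2 log λ, y) = R⁻¹ U(s, R y)` (one direction is the tree's
  `IsRotatedDSS.lerayOrbit_add_period`) on `t < 0`; self-similar ⇒ `U` steady; Type I decay
  `‖u‖ ≤ C/(‖x‖ + √(−t))` ⇔ `(1 + ‖y‖) ‖U(s, y)‖ ≤ C`.

## Mathlib / tree search

Mathlib (this pin) has no similarity variables for parabolic equations (searched `selfSimilar`,
`similarity`, `Giga`, `Kohn`: nothing). Tree: `lerayOrbit`, `eq_lerayOrbit_of_neg`,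
`HasTypeIDecay.norm_lerayOrbit_le`, `IsRotatedDSS.lerayOrbit_add_period`,
`contDiff_uncurry_lerayOrbit`, `exp_neg_half_mul_self`, `sqrt_exp_neg` (`HyperbolicDSSOrbit`),
`lerayOrbitPressure`, `ofLerayOrbit(Pressure)`, `lerayOrbit_ofLerayOrbit`, `ofLerayOrbit_lerayOrbit`,
`exp_log_neg_div_two`, `rescaledEulerLerayForce`, `IsRescaledEulerLeraySolutionOn`
(`RescaledEulerLeray`) — reused; the forward toolkit `SimilarityVariables` (`simMap`, `simPull`, `t > 0`, no weights);
the dilation calculus and Leray's reduction `LeraySelfSimilarCalculus` (`fderiv_smul_comp_smul`,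
`laplacian_smul_comp_smul`, `convect_smul_comp_smul`, `divergence_smul_comp_smul`,
`gradient_sq_mul_comp_smul_sub`, `lerayBackward_isClassical_iff_holds`); the scaling notions of
`SelfSimilar` (`nsRescale`, `IsDiscretelySelfSimilar`, `IsRotatedDSS`, `HasTypeIDecay`,
`IsLerayProfile`); the space–time slice calculus `SpaceTimeCalculus` (`hasDerivAt_timeLine`,
`hasFDerivAt_slice`, `timeDerivWithin_eq_deriv`) — all reused.

## References

* D. Chae, J. Wolf, *Removing discretely self-similar singularities for the 3D Navier–Stokes
  equations*, Comm. PDE 42 (2017) 1359–1374 = arXiv:1610.09464, §4 (proof of Thm. 1.5)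
  [ChaeWolf2017RemovingDSS].
* J. Leray, Acta Math. 63 (1934), §20, (3.11)–(3.12) [Leray1934]; J. Nečas, M. Růžička,
  V. Šverák, Acta Math. 176 (1996), (1.3)–(1.5) [NecasRuzickaSverak1996].
* P. G. Lemarié-Rieusset, *The Navier–Stokes Problem in the 21st Century* (2016), §16.4, p. 614
  (printed) [LemarieRieusset2016].
* Z. Bradshaw, T.-P. Tsai, Comm. PDE 42 (2017) = arXiv:1610.05680, §1 (rotated discretely
  self-similar fields) [BradshawTsai2017CPDE].
* G. Koch, N. Nadirashvili, G. Seregin, V. Šverák, Acta Math. 203 (2009), (1.6) (Type I bound)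
  [KNSS2009].
-/

noncomputable section

open Set Function Filter Topology InnerProductSpace
open scoped Laplacian RealInnerProductSpace ContDiff

namespace Literature.Analysis.FluidPDE

/-! ### Exponential bookkeeping -/

/-- `(e^{−s/2})² = e^{−s}`. [folklore] -/
theorem exp_neg_half_sq (s : ℝ) : Real.exp (-s / 2) ^ 2 = Real.exp (-s) := by
  rw [sq, exp_neg_half_mul_self]

/-- `(e^{−s/2})³ = e^{−s} e^{−s/2}`. [folklore] -/
theorem exp_neg_half_pow_three (s : ℝ) :
    Real.exp (-s / 2) ^ 3 = Real.exp (-s) * Real.exp (-s / 2) := by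
  rw [pow_succ, exp_neg_half_sq]

/-- `e^{−(s + L)/2} = e^{−L/2} e^{−s/2}`. [folklore] -/
theorem exp_neg_add_half (s L : ℝ) :
    Real.exp (-(s + L) / 2) = Real.exp (-L / 2) * Real.exp (-s / 2) := by
  rw [← Real.exp_add]; congr 1; ring

/-- `e^{−(s + L)} = e^{−L} e^{−s}`. [folklore] -/
theorem exp_neg_add' (s L : ℝ) : Real.exp (-(s + L)) = Real.exp (-L) * Real.exp (-s) := by
  rw [← Real.exp_add]; congr 1; ring

/-- `e^{−(s − 2 log c)/2} = c e^{−s/2}` (`c > 0`). [folklore] -/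
theorem exp_neg_sub_two_mul_log_half {c : ℝ} (hc : 0 < c) (s : ℝ) :
    Real.exp (-(s - 2 * Real.log c) / 2) = c * Real.exp (-s / 2) := by
  rw [show -(s - 2 * Real.log c) / 2 = Real.log c + -s / 2 by ring, Real.exp_add, Real.exp_log hc]

/-- `e^{−(s − 2 log c)} = c² e^{−s}` (`c > 0`). [folklore] -/
theorem exp_neg_sub_two_mul_log {c : ℝ} (hc : 0 < c) (s : ℝ) :
    Real.exp (-(s - 2 * Real.log c)) = c ^ 2 * Real.exp (-s) := by
  rw [show -(s - 2 * Real.log c) = 2 * Real.log c + -s by ring, Real.exp_add, two_mul, Real.exp_add,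
    Real.exp_log hc, sq]

/-- `−e^{−s} < 0`: the similarity time line covers the past. [folklore] -/
theorem neg_exp_neg_lt_zero (s : ℝ) : -Real.exp (-s) < 0 := neg_neg_of_pos (Real.exp_pos _)

/-- `−log(e^{−s}) = s` (`σ(τ(s)) = s` in simp-normal form). [folklore] -/
theorem neg_log_exp_neg (s : ℝ) : -Real.log (Real.exp (-s)) = s := by
  rw [Real.log_exp, neg_neg]

/-! ### The time maps `τ(s) = −e^{−s}` and `σ(t) = −log(−t)` -/

/-- The physical time of the backward similarity time `s`: `τ(s) = −e^{−s} < 0`, inverse of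
`s = −log(−t)` (Chae–Wolf 2017, §4, with `t_* = 0`). Used unapplied for the bookkeeping of time
sets (`τ '' S`, `τ⁻¹' T`); applied it is `−e^{−s}` (`ancientSimTime_apply`, `simp`). [cite: ChaeWolf2017RemovingDSS, §4 (proof of Thm. 1.5)] -/
def ancientSimTime (s : ℝ) : ℝ := -Real.exp (-s)

/-- The backward similarity time of the physical time `t < 0`: `σ(t) = −log(−t)`
(Chae–Wolf 2017, §4: "`s = −log(t_* − t)`", `t_* = 0`); junk (`= −log t`, resp. `0`) for
`t > 0`, resp. `t = 0`. [cite: ChaeWolf2017RemovingDSS, §4 (proof of Thm. 1.5)] -/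
def ancientSimTimeInv (t : ℝ) : ℝ := -Real.log (-t)

/-- Unfolding `τ`. [folklore] -/
@[simp]
theorem ancientSimTime_apply (s : ℝ) : ancientSimTime s = -Real.exp (-s) := rfl

/-- Unfolding `σ`. [folklore] -/
@[simp]
theorem ancientSimTimeInv_apply (t : ℝ) : ancientSimTimeInv t = -Real.log (-t) := rfl

/-- `τ(s) < 0`. [folklore] -/
theorem ancientSimTime_neg (s : ℝ) : ancientSimTime s < 0 := neg_exp_neg_lt_zero s

/-- `σ(τ(s)) = s`. [folklore] -/
theorem ancientSimTimeInv_ancientSimTime (s : ℝ) : ancientSimTimeInv (ancientSimTime s) = s := by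
  rw [ancientSimTime, ancientSimTimeInv, neg_neg, neg_log_exp_neg]

/-- `τ(σ(t)) = t` for `t < 0`. [folklore] -/
theorem ancientSimTime_ancientSimTimeInv {t : ℝ} (ht : t < 0) :
    ancientSimTime (ancientSimTimeInv t) = t := by
  rw [ancientSimTime, ancientSimTimeInv, neg_neg, Real.exp_log (neg_pos.2 ht), neg_neg]

/-- `τ(s + L) = e^{−L} τ(s)`: a time shift of the profile is a parabolic dilation of time. [folklore] -/
theorem ancientSimTime_add (s L : ℝ) : ancientSimTime (s + L) = Real.exp (-L) * ancientSimTime s := by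
  rw [ancientSimTime, ancientSimTime, exp_neg_add', mul_neg]

/-- `τ'(s) = e^{−s} = −τ(s)`. [folklore] -/
theorem hasDerivAt_ancientSimTime (s : ℝ) : HasDerivAt ancientSimTime (Real.exp (-s)) s := by
  have h := ((hasDerivAt_id s).neg.exp).neg
  simp only [mul_neg, mul_one, neg_neg] at h
  exact h

/-- `τ` is smooth. [folklore] -/
theorem contDiff_ancientSimTime {n : WithTop ℕ∞} : ContDiff ℝ n ancientSimTime :=
  (Real.contDiff_exp.comp contDiff_neg).neg

/-- `τ` is continuous. [folklore] -/
theorem continuous_ancientSimTime : Continuous ancientSimTime :=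
  contDiff_ancientSimTime (n := 0).continuous

/-- `τ` is strictly increasing. [folklore] -/
theorem strictMono_ancientSimTime : StrictMono ancientSimTime := fun a b hab => by
  simp only [ancientSimTime, neg_lt_neg_iff]
  exact Real.exp_lt_exp.2 (neg_lt_neg hab)

/-- `τ` is injective. [folklore] -/
theorem ancientSimTime_injective : Injective ancientSimTime := strictMono_ancientSimTime.injective

/-- The range of `τ` is the past `(−∞, 0)`. [folklore] -/
theorem range_ancientSimTime : range ancientSimTime = Iio 0 :=
  Set.ext fun t => ⟨fun ⟨s, hs⟩ => hs ▸ ancientSimTime_neg s,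
    fun ht => ⟨ancientSimTimeInv t, ancientSimTime_ancientSimTimeInv ht⟩⟩

/-- `σ` is smooth on `(−∞, 0)`. [folklore] -/
theorem contDiffOn_ancientSimTimeInv {n : WithTop ℕ∞} : ContDiffOn ℝ n ancientSimTimeInv (Iio 0) := by
  refine ContDiffOn.neg ?_
  refine Real.contDiffOn_log.comp contDiff_neg.contDiffOn fun t ht => ?_
  simp only [mem_compl_iff, mem_singleton_iff, neg_eq_zero]
  exact (mem_Iio.1 ht).ne

/-- `σ` is continuous on `(−∞, 0)`. [folklore] -/
theorem continuousOn_ancientSimTimeInv : ContinuousOn ancientSimTimeInv (Iio 0) :=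
  contDiffOn_ancientSimTimeInv (n := 0).continuousOn

/-- `σ'(t) = (−t)⁻¹` for `t < 0`. [folklore] -/
theorem hasDerivAt_ancientSimTimeInv {t : ℝ} (ht : t < 0) :
    HasDerivAt ancientSimTimeInv (-t)⁻¹ t := by
  have h := ((Real.hasDerivAt_log (neg_pos.2 ht).ne').comp t (hasDerivAt_neg t)).neg
  simp only [mul_neg, mul_one, neg_neg] at h
  exact h

/-- **Images of time sets**: `τ(S) = σ⁻¹(S) ∩ (−∞, 0)`. [folklore] -/
theorem image_ancientSimTime (S : Set ℝ) :
    ancientSimTime '' S = ancientSimTimeInv ⁻¹' S ∩ Iio 0 := by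
  ext t
  constructor
  · rintro ⟨s, hs, rfl⟩
    exact ⟨by simpa [neg_log_exp_neg] using hs, ancientSimTime_neg s⟩
  · rintro ⟨hs, ht⟩
    exact ⟨ancientSimTimeInv t, hs, ancientSimTime_ancientSimTimeInv ht⟩

/-- `τ(ℝ) = (−∞, 0)`. [folklore] -/
@[simp]
theorem image_ancientSimTime_univ : ancientSimTime '' univ = Iio 0 := by
  rw [image_univ, range_ancientSimTime]

/-- `τ⁻¹((−∞, 0)) = ℝ`: every similarity time is a past time. [folklore] -/
@[simp]
theorem preimage_ancientSimTime_Iio : ancientSimTime ⁻¹' Iio (0 : ℝ) = univ :=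
  eq_univ_of_forall fun s => ancientSimTime_neg s

/-- `τ` maps open time sets to open time sets (it is a diffeomorphism onto the open past). [folklore] -/
theorem isOpen_image_ancientSimTime {S : Set ℝ} (hS : IsOpen S) : IsOpen (ancientSimTime '' S) := by
  rw [image_ancientSimTime, inter_comm]
  exact continuousOn_ancientSimTimeInv.isOpen_inter_preimage isOpen_Iio hS

/-- `τ⁻¹(τ(S)) = S`. [folklore] -/
@[simp]
theorem preimage_image_ancientSimTime (S : Set ℝ) : ancientSimTime ⁻¹' (ancientSimTime '' S) = S :=
  ancientSimTime_injective.preimage_image S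

/-- `τ(τ⁻¹(T)) = T` for time sets in the past. [folklore] -/
theorem image_preimage_ancientSimTime {T : Set ℝ} (hT : T ⊆ Iio 0) :
    ancientSimTime '' (ancientSimTime ⁻¹' T) = T := by
  rw [image_preimage_eq_inter_range, range_ancientSimTime, inter_eq_left.2 hT]

/-- `τ⁻¹(T)` is open for open `T`. [folklore] -/
theorem isOpen_preimage_ancientSimTime {T : Set ℝ} (hT : IsOpen T) : IsOpen (ancientSimTime ⁻¹' T) :=
  hT.preimage continuous_ancientSimTime

/-! ### The space–time map `Φ(s, y) = (−e^{−s}, e^{−s/2} y)` and its inverse -/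

section Map

variable {E : Type*} [NormedAddCommGroup E] [NormedSpace ℝ E]

/-- **The backward similarity change of variables** `Φ(s, y) = (t, x) = (−e^{−s}, e^{−s/2} y)`
(time first), the inverse of `y = x/√(−t)`, `s = −log(−t)` (Chae–Wolf 2017, §4, centred at
`(x_*, t_*) = (0, 0)`): `uncurry (lerayOrbit u) z = e^{−z.1/2} • uncurry u (Φ z)`. [cite: ChaeWolf2017RemovingDSS, §4 (proof of Thm. 1.5)] -/
def ancientSimMap (z : ℝ × E) : ℝ × E := (-Real.exp (-z.1), Real.exp (-z.1 / 2) • z.2)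

/-- The map `(t, x) ↦ (s, y) = (−log(−t), x/√(−t))` of Chae–Wolf 2017, §4, inverse to
`ancientSimMap` on the past `t < 0` (junk for `t ≥ 0`). [cite: ChaeWolf2017RemovingDSS, §4 (proof of Thm. 1.5)] -/
def ancientSimInv (z : ℝ × E) : ℝ × E := (-Real.log (-z.1), (Real.sqrt (-z.1))⁻¹ • z.2)

/-- Components of `Φ`. [folklore] -/
@[simp]
theorem ancientSimMap_apply (s : ℝ) (y : E) :
    ancientSimMap (s, y) = (-Real.exp (-s), Real.exp (-s / 2) • y) := rfl

/-- Components of `Φ⁻¹`. [folklore] -/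
@[simp]
theorem ancientSimInv_apply (t : ℝ) (x : E) :
    ancientSimInv (t, x) = (-Real.log (-t), (Real.sqrt (-t))⁻¹ • x) := rfl

/-- The time component of `Φ` is `τ`. [folklore] -/
theorem ancientSimMap_fst (z : ℝ × E) : (ancientSimMap z).1 = ancientSimTime z.1 := rfl

/-- `Φ⁻¹ ∘ Φ = id`. [folklore] -/
@[simp]
theorem ancientSimInv_ancientSimMap (z : ℝ × E) : ancientSimInv (ancientSimMap z) = z := by
  obtain ⟨s, y⟩ := z
  simp only [ancientSimMap_apply, ancientSimInv_apply, neg_neg, neg_log_exp_neg, sqrt_exp_neg,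
    smul_smul, inv_mul_cancel₀ (Real.exp_pos _).ne', one_smul]

/-- `Φ ∘ Φ⁻¹ = id` on the past `t < 0`. [folklore] -/
theorem ancientSimMap_ancientSimInv {z : ℝ × E} (hz : z.1 < 0) : ancientSimMap (ancientSimInv z) = z := by
  obtain ⟨t, x⟩ := z
  have hsq : 0 < Real.sqrt (-t) := Real.sqrt_pos.2 (neg_pos.2 hz)
  simp only [ancientSimInv_apply, ancientSimMap_apply, neg_neg, Real.exp_log (neg_pos.2 hz),
    exp_log_neg_div_two hz, smul_smul, mul_inv_cancel₀ hsq.ne', one_smul]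

/-- `Φ` is injective. [folklore] -/
theorem ancientSimMap_injective : Injective (ancientSimMap : ℝ × E → ℝ × E) :=
  HasLeftInverse.injective ⟨ancientSimInv, ancientSimInv_ancientSimMap⟩

/-- `Φ(s, y)` lies in the open past `t < 0`. [folklore] -/
theorem ancientSimMap_mem_past (z : ℝ × E) : ancientSimMap z ∈ Iio (0 : ℝ) ×ˢ (univ : Set E) :=
  ⟨neg_exp_neg_lt_zero _, mem_univ _⟩

/-- The range of `Φ` is the open past `(−∞, 0) × E`. [folklore] -/
theorem range_ancientSimMap : range (ancientSimMap : ℝ × E → ℝ × E) = Iio (0 : ℝ) ×ˢ (univ : Set E) :=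
  Set.ext fun z => ⟨fun ⟨w, hw⟩ => hw ▸ ancientSimMap_mem_past w,
    fun hz => ⟨ancientSimInv z, ancientSimMap_ancientSimInv hz.1⟩⟩

/-- The scalar weight `z ↦ e^{−z.1/2}` is smooth on `ℝ × E`. [folklore] -/
theorem contDiff_exp_neg_fst_half {n : WithTop ℕ∞} : ContDiff ℝ n fun z : ℝ × E => Real.exp (-z.1 / 2) :=
  Real.contDiff_exp.comp ((contDiff_neg.comp contDiff_fst).div_const 2)

/-- The scalar weight `z ↦ e^{−z.1}` is smooth on `ℝ × E`. [folklore] -/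
theorem contDiff_exp_neg_fst {n : WithTop ℕ∞} : ContDiff ℝ n fun z : ℝ × E => Real.exp (-z.1) :=
  Real.contDiff_exp.comp (contDiff_neg.comp contDiff_fst)

/-- `Φ` is smooth. [folklore] -/
theorem contDiff_ancientSimMap {n : WithTop ℕ∞} : ContDiff ℝ n (ancientSimMap : ℝ × E → ℝ × E) :=
  (contDiff_ancientSimTime.comp contDiff_fst).prodMk (contDiff_exp_neg_fst_half.smul contDiff_snd)

/-- `Φ` is continuous. [folklore] -/
theorem continuous_ancientSimMap : Continuous (ancientSimMap : ℝ × E → ℝ × E) :=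
  (contDiff_ancientSimMap (n := 0)).continuous

/-- The scale factor `t ↦ (√(−t))⁻¹` is smooth on the past. [folklore] -/
theorem contDiffOn_inv_sqrt_neg {n : WithTop ℕ∞} :
    ContDiffOn ℝ n (fun t : ℝ => (Real.sqrt (-t))⁻¹) (Iio 0) := by
  refine ((contDiff_neg.contDiffOn).sqrt fun t ht => ?_).inv fun t ht => ?_
  · exact (neg_pos.2 (mem_Iio.1 ht)).ne'
  · exact (Real.sqrt_pos.2 (neg_pos.2 (mem_Iio.1 ht))).ne'

/-- `Φ⁻¹` is smooth on the open past `(−∞, 0) × E`. [folklore] -/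
theorem contDiffOn_ancientSimInv {n : WithTop ℕ∞} :
    ContDiffOn ℝ n (ancientSimInv : ℝ × E → ℝ × E) (Iio (0 : ℝ) ×ˢ univ) := by
  refine ContDiffOn.prodMk (contDiffOn_ancientSimTimeInv.comp contDiff_fst.contDiffOn
    fun z hz => hz.1) (ContDiffOn.smul ?_ contDiff_snd.contDiffOn)
  exact contDiffOn_inv_sqrt_neg.comp contDiff_fst.contDiffOn fun z hz => hz.1

/-- `Φ⁻¹` is continuous on the open past. [folklore] -/
theorem continuousOn_ancientSimInv :
    ContinuousOn (ancientSimInv : ℝ × E → ℝ × E) (Iio (0 : ℝ) ×ˢ univ) :=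
  contDiffOn_ancientSimInv (n := 0).continuousOn

/-- `Φ` maps `τ⁻¹(T) × E` into `T × E`. [folklore] -/
theorem mapsTo_ancientSimMap (T : Set ℝ) :
    MapsTo (ancientSimMap : ℝ × E → ℝ × E) ((ancientSimTime ⁻¹' T) ×ˢ univ) (T ×ˢ univ) :=
  fun _ hz => ⟨hz.1, mem_univ _⟩

/-- `Φ⁻¹` maps `τ(S) × E` into `S × E`. [folklore] -/
theorem mapsTo_ancientSimInv (S : Set ℝ) :
    MapsTo (ancientSimInv : ℝ × E → ℝ × E) ((ancientSimTime '' S) ×ˢ univ) (S ×ˢ univ) := by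
  rintro ⟨t, x⟩ ⟨⟨s, hs, rfl⟩, -⟩
  exact ⟨by simpa [neg_log_exp_neg] using hs, mem_univ _⟩

end Map

/-! ### The pressure and force transforms; the inverse transforms -/

section Transforms

variable {E : Type*} [NormedAddCommGroup E] [NormedSpace ℝ E]
variable {F : Type*} [NormedAddCommGroup F] [NormedSpace ℝ F]

/-- **A force (or a term of the momentum equation) in backward similarity variables** (weight
`(−t)^{3/2} = e^{−3s/2}`, written `(e^{−s/2})³`): `lerayOrbitForce f s y = (e^{−s/2})³ • f(−e^{−s}, e^{−s/2} y)`.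
Every term of the Navier–Stokes momentum equation for `u` at `(t, x) = Φ(s, y)`, transformed with
this weight, is the corresponding term of the backward Leray system for `U = lerayOrbit u`
(`lerayOrbitForce_timeDeriv`, `convect_lerayOrbit`, `laplacian_lerayOrbit`,
`gradient_lerayOrbitPressure`); a forced Navier–Stokes system transforms with force
`lerayOrbitForce f`. [folklore] -/
def lerayOrbitForce (f : ℝ → E → F) : ℝ → E → F :=
  fun s y => Real.exp (-s / 2) ^ 3 • f (-Real.exp (-s)) (Real.exp (-s / 2) • y)

/-- Unfolding `lerayOrbitForce`. [folklore] -/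
@[simp]
theorem lerayOrbitForce_apply (f : ℝ → E → F) (s : ℝ) (y : E) :
    lerayOrbitForce f s y = Real.exp (-s / 2) ^ 3 • f (-Real.exp (-s)) (Real.exp (-s / 2) • y) := rfl

/-- The velocity transform in terms of the unweighted composition with `Φ`:
`uncurry (lerayOrbit u) z = e^{−z.1/2} • (uncurry u) (Φ z)`. [folklore] -/
theorem uncurry_lerayOrbit (u : ℝ → E → F) :
    uncurry (lerayOrbit u) = fun z : ℝ × E => Real.exp (-z.1 / 2) • uncurry u (ancientSimMap z) := by
  funext ⟨s, y⟩; rfl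

/-- `uncurry (lerayOrbitPressure p) z = e^{−z.1} (uncurry p) (Φ z)`. [folklore] -/
theorem uncurry_lerayOrbitPressure (p : ℝ → E → ℝ) :
    uncurry (lerayOrbitPressure p) = fun z : ℝ × E => Real.exp (-z.1) * uncurry p (ancientSimMap z) := by
  funext ⟨s, y⟩; rfl

/-- `uncurry (ofLerayOrbit U) z = (√(−z.1))⁻¹ • (uncurry U) (Φ⁻¹ z)`. [folklore] -/
theorem uncurry_ofLerayOrbit (U : ℝ → E → F) :
    uncurry (ofLerayOrbit U) = fun z : ℝ × E => (Real.sqrt (-z.1))⁻¹ • uncurry U (ancientSimInv z) := by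
  funext ⟨t, x⟩; rfl

/-- `uncurry (ofLerayOrbitPressure P) z = (−z.1)⁻¹ (uncurry P) (Φ⁻¹ z)`. [folklore] -/
theorem uncurry_ofLerayOrbitPressure (P : ℝ → E → ℝ) :
    uncurry (ofLerayOrbitPressure P) = fun z : ℝ × E => (-z.1)⁻¹ * uncurry P (ancientSimInv z) := by
  funext ⟨t, x⟩; rfl

/-- The velocity transform is linear: `lerayOrbit (a • u) = a • lerayOrbit u`. [folklore] -/
theorem lerayOrbit_const_smul (a : ℝ) (u : ℝ → E → F) : lerayOrbit (a • u) = a • lerayOrbit u := by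
  funext s y; simp [smul_comm a]

/-- `lerayOrbit (u + v) = lerayOrbit u + lerayOrbit v`. [folklore] -/
theorem lerayOrbit_add (u v : ℝ → E → F) : lerayOrbit (u + v) = lerayOrbit u + lerayOrbit v := by
  funext s y; simp [smul_add]

/-- `lerayOrbitForce 0 = 0` (the zero force stays zero). [folklore] -/
@[simp]
theorem lerayOrbitForce_zero : lerayOrbitForce (0 : ℝ → E → F) = 0 := by
  funext s y; simp

/-- **`orbit ∘ inverse = id`** as an identity of space–time fields (the tree's pointwise
`lerayOrbit_ofLerayOrbit`): reading the physical field of a profile in similarity variables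
returns the profile. [folklore] -/
@[simp]
theorem lerayOrbit_ofLerayOrbit_eq (U : ℝ → E → F) : lerayOrbit (ofLerayOrbit U) = U :=
  funext fun s => funext fun y => lerayOrbit_ofLerayOrbit U s y

/-- `orbit ∘ inverse = id` for pressures, as an identity of fields. [folklore] -/
@[simp]
theorem lerayOrbitPressure_ofLerayOrbitPressure_eq (P : ℝ → E → ℝ) :
    lerayOrbitPressure (ofLerayOrbitPressure P) = P :=
  funext fun s => funext fun y => lerayOrbitPressure_ofLerayOrbitPressure P s y

/-- **`inverse ∘ orbit = id` on the past**, slice form: `ofLerayOrbit (lerayOrbit u) t = u t` for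
`t < 0` (the tree's pointwise `ofLerayOrbit_lerayOrbit`). [cite: ChaeWolf2017RemovingDSS, §4 (proof of Thm. 1.5)] -/
theorem ofLerayOrbit_lerayOrbit_slice (u : ℝ → E → F) {t : ℝ} (ht : t < 0) : ofLerayOrbit (lerayOrbit u) t = u t :=
  funext fun x => ofLerayOrbit_lerayOrbit u ht x

/-- `inverse ∘ orbit = id` on the past for pressures, slice form. [folklore] -/
theorem ofLerayOrbitPressure_lerayOrbitPressure_slice (p : ℝ → E → ℝ) {t : ℝ} (ht : t < 0) :
    ofLerayOrbitPressure (lerayOrbitPressure p) t = p t :=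
  funext fun x => ofLerayOrbitPressure_lerayOrbitPressure p ht x

/-- The velocity transform evaluated at `Φ⁻¹(t, x)` is `√(−t) u(t, x)`: for `t < 0`,
`lerayOrbit u (−log(−t)) ((√(−t))⁻¹ • x) = √(−t) • u t x`. [folklore] -/
theorem lerayOrbit_neg_log (u : ℝ → E → F) {t : ℝ} (ht : t < 0) (x : E) :
    lerayOrbit u (-Real.log (-t)) ((Real.sqrt (-t))⁻¹ • x) = Real.sqrt (-t) • u t x := by
  have hsq : Real.sqrt (-t) ≠ 0 := (Real.sqrt_pos.2 (neg_pos.2 ht)).ne'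
  rw [eq_lerayOrbit_of_neg u ht x, smul_smul, mul_inv_cancel₀ hsq, one_smul]

/-- **Steady profiles are Leray's backward ansatz with rate `a = ½` and blow-up time `T = 0`**:
`ofLerayOrbit (fun _ => U) = lerayBackward (1/2) 0 U` (both junk `0` for `t ≥ 0`;
Leray 1934, (3.12); Lemarié-Rieusset 2016, §16.4: "`u(t,x) = |t|^{−1/2} U(x/√|t|)`"). [cite: Leray1934, (3.12)] -/
theorem ofLerayOrbit_const (U : E → E) : ofLerayOrbit (fun _ : ℝ => U) = lerayBackward (1 / 2) 0 U := by
  funext t x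
  simp only [ofLerayOrbit_apply, lerayBackward_apply]
  rw [show (2 : ℝ) * (1 / 2) * (0 - t) = -t by ring]

/-- The pressure twin: `ofLerayOrbitPressure (fun _ => P) = lerayBackwardPressure (1/2) 0 P`. [cite: Leray1934, (3.12)] -/
theorem ofLerayOrbitPressure_const (P : E → ℝ) :
    ofLerayOrbitPressure (fun _ : ℝ => P) = lerayBackwardPressure (1 / 2) 0 P := by
  funext t x
  simp only [ofLerayOrbitPressure_apply, lerayBackwardPressure]
  rw [show (2 : ℝ) * (1 / 2) * (0 - t) = -t by ring]

/-- Leray's backward ansatz (`a = ½`, `T = 0`) read in similarity variables is the steady profile: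
`lerayOrbit (lerayBackward (1/2) 0 U) = fun _ => U`. [cite: Leray1934, (3.12)] -/
@[simp]
theorem lerayOrbit_lerayBackward (U : E → E) : lerayOrbit (lerayBackward (1 / 2) 0 U) = fun _ => U := by
  rw [← ofLerayOrbit_const U, lerayOrbit_ofLerayOrbit_eq]

/-- `lerayOrbitPressure (lerayBackwardPressure (1/2) 0 P) = fun _ => P`. [cite: Leray1934, (3.12)] -/
@[simp]
theorem lerayOrbitPressure_lerayBackwardPressure (P : E → ℝ) :
    lerayOrbitPressure (lerayBackwardPressure (1 / 2) 0 P) = fun _ => P := by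
  rw [← ofLerayOrbitPressure_const, lerayOrbitPressure_ofLerayOrbitPressure_eq]

end Transforms

/-! ### Dictionary: chain rules for the transformed fields -/

section ChainRules

variable {E : Type*} [NormedAddCommGroup E] [InnerProductSpace ℝ E] [FiniteDimensional ℝ E]
variable {F : Type*} [NormedAddCommGroup F] [NormedSpace ℝ F]

omit [InnerProductSpace ℝ E] [FiniteDimensional ℝ E] in
/-- At fixed `s` the velocity transform is the dilation `y ↦ c • u(t, c • y)` with `c = e^{−s/2}`,
`t = −e^{−s}` (definitional). [folklore] -/
theorem lerayOrbit_slice [NormedSpace ℝ E] (u : ℝ → E → F) (s : ℝ) :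
    lerayOrbit u s = fun y => Real.exp (-s / 2) • u (-Real.exp (-s)) (Real.exp (-s / 2) • y) :=
  rfl

omit [InnerProductSpace ℝ E] [FiniteDimensional ℝ E] in
/-- **Chain rule in space**: `D_y U(s, ·)(y) = e^{−s} • D_x u(t, ·)(x)` at `(t, x) = Φ(s, y)`: the
velocity gradient transforms with the vorticity weight `−t` (no differentiability needed). [folklore] -/
theorem fderiv_lerayOrbit [NormedSpace ℝ E] (u : ℝ → E → F) (s : ℝ) (y : E) :
    fderiv ℝ (lerayOrbit u s) y = Real.exp (-s) • fderiv ℝ (u (-Real.exp (-s))) (Real.exp (-s / 2) • y) := by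
  rw [lerayOrbit_slice, fderiv_smul_comp_smul, exp_neg_half_sq]

omit [FiniteDimensional ℝ E] in
/-- **Chain rule for the divergence**: `div U(s, ·)(y) = e^{−s} div u(t, ·)(x)` (the pressure
weight). [folklore] -/
theorem divergence_lerayOrbit (u : ℝ → E → E) (s : ℝ) (y : E) :
    VectorCalculus.divergence (lerayOrbit u s) y =
      Real.exp (-s) * VectorCalculus.divergence (u (-Real.exp (-s))) (Real.exp (-s / 2) • y) := by
  rw [lerayOrbit_slice, divergence_smul_comp_smul, exp_neg_half_sq]

omit [FiniteDimensional ℝ E] in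
/-- **`div U = 0 ↔ div u(t) = 0`** at `t = −e^{−s}` (the dilation `y ↦ e^{−s/2} y` is onto). [folklore] -/
theorem isDivFree_lerayOrbit_iff (u : ℝ → E → E) (s : ℝ) :
    VectorCalculus.IsDivFree (lerayOrbit u s) ↔ VectorCalculus.IsDivFree (u (-Real.exp (-s))) := by
  have ha : Real.exp (-s / 2) ≠ 0 := (Real.exp_pos _).ne'
  constructor
  · intro h x
    have key := h ((Real.exp (-s / 2))⁻¹ • x)
    rw [divergence_lerayOrbit, smul_smul, mul_inv_cancel₀ ha, one_smul, mul_eq_zero] at key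
    exact key.resolve_left (Real.exp_pos _).ne'
  · intro h y
    rw [divergence_lerayOrbit, h, mul_zero]

omit [FiniteDimensional ℝ E] in
/-- **Chain rule for the convection term**: `((U·∇)U)(s, y) = e^{−3s/2} ((u·∇)u)(t, x)`, i.e.
`(U·∇)U = lerayOrbitForce ((u·∇)u)`. [folklore] -/
theorem convect_lerayOrbit (u : ℝ → E → E) (s : ℝ) (y : E) :
    convect (lerayOrbit u s) (lerayOrbit u s) y = lerayOrbitForce (fun t x => convect (u t) (u t) x) s y := by
  rw [lerayOrbitForce_apply, lerayOrbit_slice, convect_smul_comp_smul]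

/-- **Chain rule for the Laplacian** (slice `u(t) ∈ C²`): `ΔU(s, y) = e^{−3s/2} Δu(t, x)`, i.e.
`ΔU = lerayOrbitForce (Δu)`. [folklore] -/
theorem laplacian_lerayOrbit {F' : Type*} [NormedAddCommGroup F'] [InnerProductSpace ℝ F']
    (u : ℝ → E → F') (s : ℝ) (y : E) (h : ContDiff ℝ 2 (u (-Real.exp (-s)))) :
    (Δ (lerayOrbit u s)) y = lerayOrbitForce (fun t x => (Δ (u t)) x) s y := by
  rw [lerayOrbitForce_apply, lerayOrbit_slice, laplacian_smul_comp_smul h]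

/-- **Chain rule for the pressure gradient**: `∇P(s, y) = e^{−3s/2} ∇p(t, x)`, i.e.
`∇P = lerayOrbitForce (∇p)` (no differentiability needed). [folklore] -/
theorem gradient_lerayOrbitPressure (p : ℝ → E → ℝ) (s : ℝ) (y : E) :
    gradient (lerayOrbitPressure p s) y = lerayOrbitForce (fun t x => gradient (p t) x) s y := by
  have h : lerayOrbitPressure p s =
      fun y => Real.exp (-s / 2) ^ 2 * (p (-Real.exp (-s)) (Real.exp (-s / 2) • y) - 0) := by
    funext y
    rw [sub_zero, exp_neg_half_sq]
    rfl
  rw [h, gradient_sq_mul_comp_smul_sub, lerayOrbitForce_apply]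

omit [InnerProductSpace ℝ E] [FiniteDimensional ℝ E] in
/-- `d/dr e^{−r/2} = −½ e^{−r/2}`. [folklore] -/
theorem hasDerivAt_exp_neg_half (s : ℝ) :
    HasDerivAt (fun r : ℝ => Real.exp (-r / 2)) (-(1 : ℝ) / 2 * Real.exp (-s / 2)) s := by
  have h := (hasDerivAt_mul_const (-(1 : ℝ) / 2) (x := s)).exp
  rw [show s * (-(1 : ℝ) / 2) = -s / 2 by ring] at h
  have e : (fun r : ℝ => Real.exp (-r / 2)) = fun r => Real.exp (r * (-(1 : ℝ) / 2)) := by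
    funext r; congr 1; ring
  rw [e]
  convert h using 1
  ring

omit [InnerProductSpace ℝ E] [FiniteDimensional ℝ E] in
/-- The velocity of the curve `r ↦ Φ(r, y)`: `(e^{−s}, −½ e^{−s/2} y)` at `r = s`. [folklore] -/
theorem hasDerivAt_ancientSimMap_line [NormedSpace ℝ E] (s : ℝ) (y : E) :
    HasDerivAt (fun r : ℝ => ancientSimMap (r, y))
      (Real.exp (-s), (-(1 : ℝ) / 2 * Real.exp (-s / 2)) • y) s :=
  (hasDerivAt_ancientSimTime s).prodMk ((hasDerivAt_exp_neg_half s).smul_const y)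

omit [InnerProductSpace ℝ E] [FiniteDimensional ℝ E] in
/-- **Chain rule in time** (`HasDerivAt` form): if `uncurry u` is differentiable at `Φ(s, y)` with
derivative `L`, then `r ↦ U(r, y) = e^{−r/2} u(Φ(r, y))` has derivative
`e^{−3s/2} L(1, 0) − ½ e^{−s/2} u(Φ(s, y)) − ½ e^{−s} L(0, y)` at `s` (product rule and the velocity
`(e^{−s}, −½ e^{−s/2} y)` of the curve `r ↦ Φ(r, y)`). [folklore] -/
theorem hasDerivAt_lerayOrbit [NormedSpace ℝ E] {u : ℝ → E → F} {s : ℝ} {y : E}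
    {L : ℝ × E →L[ℝ] F} (h : HasFDerivAt (uncurry u) L (ancientSimMap (s, y))) :
    HasDerivAt (fun r => lerayOrbit u r y)
      ((Real.exp (-s / 2) * Real.exp (-s)) • L (1, 0)
        - ((1 / 2 : ℝ) * Real.exp (-s / 2)) • u (-Real.exp (-s)) (Real.exp (-s / 2) • y)
        - ((1 / 2 : ℝ) * Real.exp (-s / 2) ^ 2) • L (0, y)) s := by
  have hc := h.comp_hasDerivAt s (hasDerivAt_ancientSimMap_line s y)
  have hprod := (hasDerivAt_exp_neg_half s).smul hc
  have he : (fun r => lerayOrbit u r y) =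
      (fun r : ℝ => Real.exp (-r / 2)) • (uncurry u ∘ fun r : ℝ => ancientSimMap (r, y)) := by
    funext r; rfl
  rw [he]
  convert hprod using 1
  have h4 : ((Real.exp (-s), (-(1 : ℝ) / 2 * Real.exp (-s / 2)) • y) : ℝ × E) =
      Real.exp (-s) • ((1 : ℝ), (0 : E)) + (-(1 : ℝ) / 2 * Real.exp (-s / 2)) • ((0 : ℝ), y) := by
    simp
  rw [show (uncurry u ∘ fun r : ℝ => ancientSimMap (r, y)) s = u (-Real.exp (-s)) (Real.exp (-s / 2) • y)
    from rfl, h4, map_add, map_smul, map_smul]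
  module

omit [InnerProductSpace ℝ E] [FiniteDimensional ℝ E] in
/-- **Chain rule in time** (`timeDeriv` form): for `uncurry u` differentiable at `Φ(s, y)`,
`∂ₛU + ½U + ½(y·∇)U = e^{−3s/2} ∂ₜu(t, x)` at `(t, x) = Φ(s, y)`, i.e. the linear "Leray part" of
the profile equation is the transformed time derivative,
`∂ₛU + ½U + ½(y·∇)U = lerayOrbitForce (∂ₜu)` (Chae–Wolf 2017, §4: the terms
`U_s + ½U + ½(y·∇)U` of the transformed system). [cite: ChaeWolf2017RemovingDSS, §4 (proof of Thm. 1.5)] -/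
theorem lerayOrbitForce_timeDeriv [NormedSpace ℝ E] {u : ℝ → E → F} {s : ℝ} {y : E}
    (h : DifferentiableAt ℝ (uncurry u) (ancientSimMap (s, y))) :
    timeDeriv (lerayOrbit u) s y + (1 / 2 : ℝ) • lerayOrbit u s y
        + (1 / 2 : ℝ) • fderiv ℝ (lerayOrbit u s) y y =
      lerayOrbitForce (timeDeriv u) s y := by
  set L := fderiv ℝ (uncurry u) (ancientSimMap (s, y)) with hL
  have hu : HasFDerivAt (uncurry u) L (-Real.exp (-s), Real.exp (-s / 2) • y) := h.hasFDerivAt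
  rw [timeDeriv_apply, (hasDerivAt_lerayOrbit hu).deriv, lerayOrbitForce_apply, timeDeriv_apply,
    (hasDerivAt_timeLine hu).deriv, fderiv_lerayOrbit, (hasFDerivAt_slice hu).fderiv, lerayOrbit_apply,
    ← exp_neg_half_sq]
  simp only [smul_apply, ContinuousLinearMap.coe_comp, Function.comp_apply, ContinuousLinearMap.inr_apply]
  module

/-! ### Smoothness transfer -/

omit [InnerProductSpace ℝ E] [FiniteDimensional ℝ E] in
/-- **Joint smoothness transfers to the orbit**: if `u` is jointly smooth on `T × E` then
`U = lerayOrbit u` is jointly smooth on `τ⁻¹(T) × E` (`Φ` is smooth and maps `τ⁻¹(T) × E` into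
`T × E`; for `T = (−∞, 0)` this is the tree's `contDiff_uncurry_lerayOrbit`). [folklore] -/
theorem IsSmoothSpaceTimeOn.lerayOrbit [NormedSpace ℝ E] {T : Set ℝ} {u : ℝ → E → F}
    (h : IsSmoothSpaceTimeOn T u) : IsSmoothSpaceTimeOn (ancientSimTime ⁻¹' T) (lerayOrbit u) := by
  unfold IsSmoothSpaceTimeOn at h ⊢
  rw [uncurry_lerayOrbit]
  exact contDiff_exp_neg_fst_half.contDiffOn.smul
    (h.comp contDiff_ancientSimMap.contDiffOn (mapsTo_ancientSimMap T))

omit [InnerProductSpace ℝ E] [FiniteDimensional ℝ E] in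
/-- Joint smoothness of the transformed pressure on `τ⁻¹(T) × E`. [folklore] -/
theorem IsSmoothSpaceTimeOn.lerayOrbitPressure [NormedSpace ℝ E] {T : Set ℝ} {p : ℝ → E → ℝ}
    (h : IsSmoothSpaceTimeOn T p) : IsSmoothSpaceTimeOn (ancientSimTime ⁻¹' T) (lerayOrbitPressure p) := by
  unfold IsSmoothSpaceTimeOn at h ⊢
  rw [uncurry_lerayOrbitPressure]
  exact contDiff_exp_neg_fst.contDiffOn.mul
    (h.comp contDiff_ancientSimMap.contDiffOn (mapsTo_ancientSimMap T))

omit [InnerProductSpace ℝ E] [FiniteDimensional ℝ E] in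
/-- **Joint smoothness transfers back**: if `U` is jointly smooth on `S × E` then
`u = ofLerayOrbit U` is jointly smooth on `τ(S) × E` (`Φ⁻¹` is smooth on the open past and maps
`τ(S) × E` into `S × E`). [folklore] -/
theorem IsSmoothSpaceTimeOn.ofLerayOrbit [NormedSpace ℝ E] {S : Set ℝ} {U : ℝ → E → F}
    (h : IsSmoothSpaceTimeOn S U) : IsSmoothSpaceTimeOn (ancientSimTime '' S) (ofLerayOrbit U) := by
  unfold IsSmoothSpaceTimeOn at h ⊢
  rw [uncurry_ofLerayOrbit]
  have hsub : (ancientSimTime '' S) ×ˢ (univ : Set E) ⊆ Iio (0 : ℝ) ×ˢ univ :=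
    prod_mono (by rw [← range_ancientSimTime]; exact image_subset_range _ _) Subset.rfl
  refine ContDiffOn.smul ?_ (h.comp (contDiffOn_ancientSimInv.mono hsub) (mapsTo_ancientSimInv S))
  exact contDiffOn_inv_sqrt_neg.comp contDiff_fst.contDiffOn fun z hz => (hsub hz).1

omit [InnerProductSpace ℝ E] [FiniteDimensional ℝ E] in
/-- Joint smoothness of the physical pressure of a pressure profile on `τ(S) × E`. [folklore] -/
theorem IsSmoothSpaceTimeOn.ofLerayOrbitPressure [NormedSpace ℝ E] {S : Set ℝ} {P : ℝ → E → ℝ}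
    (h : IsSmoothSpaceTimeOn S P) :
    IsSmoothSpaceTimeOn (ancientSimTime '' S) (ofLerayOrbitPressure P) := by
  unfold IsSmoothSpaceTimeOn at h ⊢
  rw [uncurry_ofLerayOrbitPressure]
  have hsub : (ancientSimTime '' S) ×ˢ (univ : Set E) ⊆ Iio (0 : ℝ) ×ˢ univ :=
    prod_mono (by rw [← range_ancientSimTime]; exact image_subset_range _ _) Subset.rfl
  refine ContDiffOn.mul ?_ (h.comp (contDiffOn_ancientSimInv.mono hsub) (mapsTo_ancientSimInv S))
  refine (contDiff_neg.comp contDiff_fst).contDiffOn.inv fun z hz => ?_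
  exact (neg_pos.2 (mem_Iio.1 (hsub hz).1)).ne'

end ChainRules

/-! ### The backward Leray system and its equivalence with Navier–Stokes on the past -/

section Leray

variable {E : Type*} [NormedAddCommGroup E] [InnerProductSpace ℝ E] [FiniteDimensional ℝ E]

/-- Classical solutions of the **backward (time-dependent) Leray system** with viscosity `ν` on the
time set `S` (in the similarity time `s`):
`∂ₛU + ½U + ½(y·∇)U + (U·∇)U + ∇P = νΔU`, `div U = 0` on `S × E`, with `U`, `P` jointly `C^∞`
on `S × E` (Chae–Wolf 2017, §4: "`U_s + ½U + ½(y·∇)U + (U·∇)U − ΔU = −∇P`, `∇·U = 0`", `ν = 1`)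
— by definition (an `abbrev`, like the tree's `IsRescaledEulerLeraySolutionOn`) the accepted
notion `IsClassicalNSSolutionOn S ν f U P` of classical Navier–Stokes solution with viscosity `ν` and
Leray's drift force `f = rescaledEulerLerayForce 1 U = −½(U + (y·∇)U)`, so that every tool for
classical solutions applies verbatim and `IsBackwardLeraySolutionOn S 1 = IsRescaledEulerLeraySolutionOn S 1`
definitionally (`isBackwardLeraySolutionOn_one_iff`); Leray's form of the momentum equation is
`IsBackwardLeraySolutionOn.momentum_leray` / `.of_leray`. The conventions are those of
`IsClassicalNSSolutionOn`: one-sided time derivative `timeDerivWithin S`,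
`(y·∇)U (y) = DU(y)[y] = fderiv ℝ (U s) y y`, `(U·∇)U = convect (U s) (U s)`.
For `U = lerayOrbit u`, `P = lerayOrbitPressure p` and open `T ⊆ (−∞, 0)` this is equivalent to
`(u, p)` being a classical unforced Navier–Stokes solution on `T`
(`isClassicalNSSolutionOn_iff_isBackwardLeraySolutionOn_lerayOrbit`); `s`-independent solutions on
`S = univ` are exactly Leray's profiles `IsLerayProfile ν (1/2)` (`isBackwardLeraySolutionOn_const_iff`). [cite: ChaeWolf2017RemovingDSS, §4 (proof of Thm. 1.5)] -/
abbrev IsBackwardLeraySolutionOn (S : Set ℝ) (ν : ℝ) (U : ℝ → E → E) (P : ℝ → E → ℝ) : Prop :=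
  IsClassicalNSSolutionOn S ν (rescaledEulerLerayForce 1 U) U P

/-- The abbreviation, unfolded: classical Navier–Stokes with viscosity `ν` and Leray's drift force
`−½(U + (y·∇)U)` (definitional). [folklore] -/
theorem isBackwardLeraySolutionOn_iff (S : Set ℝ) (ν : ℝ) (U : ℝ → E → E) (P : ℝ → E → ℝ) :
    IsBackwardLeraySolutionOn S ν U P ↔
      IsClassicalNSSolutionOn S ν (fun s y => -(((1 : ℝ) / 2) • (U s y + fderiv ℝ (U s) y y))) U P :=
  Iff.rfl

/-- **For `ν = 1` the backward Leray system IS the tree's rescaled Euler–Leray system with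
`ε = 1`** (`IsRescaledEulerLeraySolutionOn`, route `EulerMelnikovDss`), definitionally. [folklore] -/
theorem isBackwardLeraySolutionOn_one_iff (S : Set ℝ) (U : ℝ → E → E) (P : ℝ → E → ℝ) :
    IsBackwardLeraySolutionOn S 1 U P ↔ IsRescaledEulerLeraySolutionOn S 1 U P :=
  Iff.rfl

/-- The two shapes of the momentum equation: Leray's form
`∂ₛU + ½U + ½(y·∇)U + (U·∇)U + ∇P = νΔU` versus the forced Navier–Stokes form
`∂ₛU + (U·∇)U = νΔU − ∇P + (−½(U + (y·∇)U))` (pure rearrangement). [folklore] -/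
theorem leray_momentum_iff {F : Type*} [AddCommGroup F] [Module ℝ F] (td U T C G L : F) :
    td + (1 / 2 : ℝ) • U + (1 / 2 : ℝ) • T + C + G = L ↔ td + C = L - G + -(((1 : ℝ) / 2) • (U + T)) := by
  constructor
  · intro h
    rw [← h, smul_add]
    abel
  · intro h
    have e : td + (1 / 2 : ℝ) • U + (1 / 2 : ℝ) • T + C + G - L =
        (td + C) - (L - G + -(((1 : ℝ) / 2) • (U + T))) := by
      rw [smul_add]; abel
    rw [← sub_eq_zero, e, h, sub_self]

/-- **Leray's form of the momentum equation** of a solution of the backward Leray system: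
`∂ₛU + ½U + ½(y·∇)U + (U·∇)U + ∇P = νΔU` at `s ∈ S` (Chae–Wolf 2017, §4). [cite: ChaeWolf2017RemovingDSS, §4 (proof of Thm. 1.5)] -/
theorem IsBackwardLeraySolutionOn.momentum_leray {S : Set ℝ} {ν : ℝ} {U : ℝ → E → E} {P : ℝ → E → ℝ}
    (h : IsBackwardLeraySolutionOn S ν U P) {s : ℝ} (hs : s ∈ S) (y : E) :
    timeDerivWithin S U s y + (1 / 2 : ℝ) • U s y + (1 / 2 : ℝ) • fderiv ℝ (U s) y y
        + convect (U s) (U s) y + gradient (P s) y = ν • (Δ (U s)) y :=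
  (leray_momentum_iff _ _ _ _ _ _).2 (h.momentum s hs y)

/-- Constructor from Leray's form of the momentum equation. [folklore] -/
theorem IsBackwardLeraySolutionOn.of_leray {S : Set ℝ} {ν : ℝ} {U : ℝ → E → E} {P : ℝ → E → ℝ}
    (hu : IsSmoothSpaceTimeOn S U) (hp : IsSmoothSpaceTimeOn S P)
    (hm : ∀ s ∈ S, ∀ y, timeDerivWithin S U s y + (1 / 2 : ℝ) • U s y + (1 / 2 : ℝ) • fderiv ℝ (U s) y y
      + convect (U s) (U s) y + gradient (P s) y = ν • (Δ (U s)) y)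
    (hdiv : ∀ s ∈ S, VectorCalculus.IsDivFree (U s)) : IsBackwardLeraySolutionOn S ν U P :=
  ⟨hu, hp, fun s hs y => (leray_momentum_iff _ _ _ _ _ _).1 (hm s hs y), hdiv⟩

/-- **The momentum equation term by term**: if `uncurry u` is differentiable at `Φ(s, y)` and the
slice `u(t)`, `t = −e^{−s}`, is `C²`, then the backward Leray momentum equation (forced
Navier–Stokes shape, two-sided time derivative) for `(U, P) = (lerayOrbit u, lerayOrbitPressure p)`
holds at `(s, y)` iff the Navier–Stokes momentum
equation (viscosity `ν`, zero force, two-sided time derivative) for `(u, p)` holds at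
`(t, x) = Φ(s, y)`: every term of the former is `e^{−3s/2}` times the corresponding term of the
latter (`lerayOrbitForce_timeDeriv`, `convect_lerayOrbit`, `laplacian_lerayOrbit`,
`gradient_lerayOrbitPressure`). [cite: ChaeWolf2017RemovingDSS, §4 (proof of Thm. 1.5)] -/
theorem lerayOrbit_momentum_iff {ν : ℝ} {u : ℝ → E → E} {p : ℝ → E → ℝ} {s : ℝ} {y : E}
    (hd : DifferentiableAt ℝ (uncurry u) (ancientSimMap (s, y))) (h2 : ContDiff ℝ 2 (u (-Real.exp (-s)))) :
    timeDeriv (lerayOrbit u) s y + convect (lerayOrbit u s) (lerayOrbit u s) y =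
        ν • (Δ (lerayOrbit u s)) y - gradient (lerayOrbitPressure p s) y
          + rescaledEulerLerayForce 1 (lerayOrbit u) s y ↔
      timeDeriv u (-Real.exp (-s)) (Real.exp (-s / 2) • y)
          + convect (u (-Real.exp (-s))) (u (-Real.exp (-s))) (Real.exp (-s / 2) • y) =
        ν • (Δ (u (-Real.exp (-s)))) (Real.exp (-s / 2) • y)
          - gradient (p (-Real.exp (-s))) (Real.exp (-s / 2) • y) := by
  rw [rescaledEulerLerayForce_apply, ← leray_momentum_iff, lerayOrbitForce_timeDeriv hd, convect_lerayOrbit,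
    laplacian_lerayOrbit _ _ _ h2, gradient_lerayOrbitPressure]
  simp only [lerayOrbitForce_apply]
  set a : ℝ := Real.exp (-s / 2) with ha_def
  set T := timeDeriv u (-Real.exp (-s)) (a • y)
  set C := convect (u (-Real.exp (-s))) (u (-Real.exp (-s))) (a • y)
  set G := gradient (p (-Real.exp (-s))) (a • y)
  set D := (Δ (u (-Real.exp (-s)))) (a • y)
  have ha : a ^ 3 ≠ 0 := pow_ne_zero _ (Real.exp_pos _).ne'
  have key : a ^ 3 • (T + C - (ν • D - G)) = (a ^ 3 • T + a ^ 3 • C + a ^ 3 • G) - ν • a ^ 3 • D := by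
    module
  constructor
  · intro h
    have h0 : a ^ 3 • (T + C - (ν • D - G)) = 0 := by rw [key, h, sub_self]
    rwa [smul_eq_zero_iff_right ha, sub_eq_zero] at h0
  · intro h
    rw [← sub_eq_zero, ← key, h, sub_self, smul_zero]

/-- **Navier–Stokes on the past ⇔ the backward Leray system in similarity variables.** For an
open time set `T ⊆ (−∞, 0)`, `(u, p)` is a classical unforced Navier–Stokes solution with
viscosity `ν` on `T × E` if and only if `(U, P) = (lerayOrbit u, lerayOrbitPressure p)` is a
classical solution of the backward Leray system on `τ⁻¹(T) × E` (Chae–Wolf 2017, §4, where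
`T = (−∞, t_*)` and `ν = 1`; the steady case is Leray 1934, (3.11)–(3.12)). *Proof*: joint
smoothness transfers along the diffeomorphism `Φ` (`IsSmoothSpaceTimeOn.lerayOrbit`,
`.ofLerayOrbit` and `inv ∘ orbit = id` on the past); on open time sets the one-sided time
derivatives are two-sided; the equations correspond point by point (`lerayOrbit_momentum_iff`,
`isDivFree_lerayOrbit_iff`). [cite: ChaeWolf2017RemovingDSS, §4 (proof of Thm. 1.5)] -/
theorem isClassicalNSSolutionOn_iff_isBackwardLeraySolutionOn_lerayOrbit {T : Set ℝ} (hT : IsOpen T)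
    (hT0 : T ⊆ Iio 0) {ν : ℝ} {u : ℝ → E → E} {p : ℝ → E → ℝ} :
    IsClassicalNSSolutionOn T ν 0 u p ↔
      IsBackwardLeraySolutionOn (ancientSimTime ⁻¹' T) ν (lerayOrbit u) (lerayOrbitPressure p) := by
  have hS : IsOpen (ancientSimTime ⁻¹' T) := isOpen_preimage_ancientSimTime hT
  constructor
  · intro h
    refine ⟨h.smooth_velocity.lerayOrbit, h.smooth_pressure.lerayOrbitPressure, fun s hs y => ?_,
      fun s hs => (isDivFree_lerayOrbit_iff u s).2 (h.divFree _ hs)⟩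
    have ht : -Real.exp (-s) ∈ T := hs
    have hd : DifferentiableAt ℝ (uncurry u) (ancientSimMap (s, y)) :=
      (h.smooth_velocity.contDiffAt hT ht _).differentiableAt (by simp)
    have h2 : ContDiff ℝ 2 (u (-Real.exp (-s))) := (h.contDiff_velocity ht).of_le (by norm_cast)
    rw [timeDerivWithin_eq_deriv hS hs, ← timeDeriv_apply, lerayOrbit_momentum_iff hd h2]
    have hm := h.momentum _ ht (Real.exp (-s / 2) • y)
    rw [timeDerivWithin_eq_deriv hT ht, ← timeDeriv_apply] at hm
    simpa only [Pi.zero_apply, add_zero] using hm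
  · intro h
    have hsm_u : IsSmoothSpaceTimeOn T u := by
      have h1 := h.smooth_velocity.ofLerayOrbit
      rw [image_preimage_ancientSimTime hT0] at h1
      refine ContDiffOn.congr h1 ?_
      rintro ⟨t, x⟩ ⟨ht, -⟩
      simp only [uncurry_apply_pair, ofLerayOrbit_lerayOrbit_slice u (hT0 ht)]
    have hsm_p : IsSmoothSpaceTimeOn T p := by
      have h1 := h.smooth_pressure.ofLerayOrbitPressure
      rw [image_preimage_ancientSimTime hT0] at h1
      refine ContDiffOn.congr h1 ?_
      rintro ⟨t, x⟩ ⟨ht, -⟩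
      simp only [uncurry_apply_pair, ofLerayOrbitPressure_lerayOrbitPressure_slice p (hT0 ht)]
    refine ⟨hsm_u, hsm_p, fun t ht x => ?_, fun t ht => ?_⟩
    · have ht0 : t < 0 := hT0 ht
      set s := -Real.log (-t) with hs_def
      have hts : -Real.exp (-s) = t := by rw [hs_def, neg_neg, Real.exp_log (neg_pos.2 ht0), neg_neg]
      have hs : s ∈ ancientSimTime ⁻¹' T := by
        show -Real.exp (-s) ∈ T
        rw [hts]; exact ht
      have ha : Real.exp (-s / 2) ≠ 0 := (Real.exp_pos _).ne'
      set y := (Real.exp (-s / 2))⁻¹ • x with hy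
      have hxy : Real.exp (-s / 2) • y = x := by
        rw [hy, smul_smul, mul_inv_cancel₀ ha, one_smul]
      have hd : DifferentiableAt ℝ (uncurry u) (ancientSimMap (s, y)) := by
        rw [ancientSimMap_apply, hts, hxy]
        exact (hsm_u.contDiffAt hT ht x).differentiableAt (by simp)
      have h2 : ContDiff ℝ 2 (u (-Real.exp (-s))) := by
        rw [hts]; exact (hsm_u.contDiff_slice ht).of_le (by norm_cast)
      have hm := h.momentum s hs y
      rw [timeDerivWithin_eq_deriv hS hs, ← timeDeriv_apply, lerayOrbit_momentum_iff hd h2, hts, hxy] at hm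
      rw [timeDerivWithin_eq_deriv hT ht, ← timeDeriv_apply]
      simpa only [Pi.zero_apply, add_zero] using hm
    · have ht0 : t < 0 := hT0 ht
      have hts : -Real.exp (-(-Real.log (-t))) = t := by rw [neg_neg, Real.exp_log (neg_pos.2 ht0), neg_neg]
      have hs : -Real.log (-t) ∈ ancientSimTime ⁻¹' T := by
        show -Real.exp (-(-Real.log (-t))) ∈ T
        rw [hts]; exact ht
      have key := (isDivFree_lerayOrbit_iff u _).1 (h.divFree _ hs)
      rwa [hts] at key

/-- **The whole past.** `(u, p)` is a classical unforced Navier–Stokes solution on `(−∞, 0) × E`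
iff `(lerayOrbit u, lerayOrbitPressure p)` solves the backward Leray system on all of `ℝ × E`
(Chae–Wolf 2017, §4 with `t_* = 0`). [cite: ChaeWolf2017RemovingDSS, §4 (proof of Thm. 1.5)] -/
theorem isClassicalNSSolutionOn_Iio_iff_isBackwardLeraySolutionOn {ν : ℝ} {u : ℝ → E → E} {p : ℝ → E → ℝ} :
    IsClassicalNSSolutionOn (Iio 0) ν 0 u p ↔
      IsBackwardLeraySolutionOn univ ν (lerayOrbit u) (lerayOrbitPressure p) := by
  rw [isClassicalNSSolutionOn_iff_isBackwardLeraySolutionOn_lerayOrbit isOpen_Iio Subset.rfl,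
    preimage_ancientSimTime_Iio]

/-- **Profiles to physical solutions.** For an open set `S` of similarity times, the physical pair
`(ofLerayOrbit U, ofLerayOrbitPressure P)` is a classical unforced Navier–Stokes solution on
`τ(S) × E` iff `(U, P)` solves the backward Leray system on `S × E` (what the constructor of a
(rotated, discretely) self-similar solution has to verify; Chae–Wolf 2017, §4). [cite: ChaeWolf2017RemovingDSS, §4 (proof of Thm. 1.5)] -/
theorem isClassicalNSSolutionOn_ofLerayOrbit_iff {S : Set ℝ} (hS : IsOpen S) {ν : ℝ} {U : ℝ → E → E}
    {P : ℝ → E → ℝ} :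
    IsClassicalNSSolutionOn (ancientSimTime '' S) ν 0 (ofLerayOrbit U) (ofLerayOrbitPressure P) ↔
      IsBackwardLeraySolutionOn S ν U P := by
  rw [isClassicalNSSolutionOn_iff_isBackwardLeraySolutionOn_lerayOrbit (isOpen_image_ancientSimTime hS)
    (by rw [← range_ancientSimTime]; exact image_subset_range _ _), preimage_image_ancientSimTime,
    lerayOrbit_ofLerayOrbit_eq, lerayOrbitPressure_ofLerayOrbitPressure_eq]

/-- The whole past, profile form: `(ofLerayOrbit U, ofLerayOrbitPressure P)` is a classical
unforced Navier–Stokes solution on `(−∞, 0) × E` iff `(U, P)` solves the backward Leray system on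
`ℝ × E`. [cite: ChaeWolf2017RemovingDSS, §4 (proof of Thm. 1.5)] -/
theorem isClassicalNSSolutionOn_Iio_ofLerayOrbit_iff {ν : ℝ} {U : ℝ → E → E} {P : ℝ → E → ℝ} :
    IsClassicalNSSolutionOn (Iio 0) ν 0 (ofLerayOrbit U) (ofLerayOrbitPressure P) ↔
      IsBackwardLeraySolutionOn univ ν U P := by
  rw [← image_ancientSimTime_univ, isClassicalNSSolutionOn_ofLerayOrbit_iff isOpen_univ]

/-- **Steady solutions of the backward Leray system are Leray's profiles with rate `a = ½`** (and
viscosity `ν`): for smooth `U`, `P`, the `s`-independent pair solves the system on `ℝ × E` iff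
`IsLerayProfile ν (1/2) U P`, i.e. `−νΔU + ½U + ½(y·∇)U + (U·∇)U + ∇P = 0`, `div U = 0`
(Leray 1934, (3.11); Nečas–Růžička–Šverák 1996, (1.4)–(1.5) with `a = ½`). This is the sign check
of the conventions against `SelfSimilar.lean`. [cite: Leray1934, (3.11)–(3.12)] -/
theorem isBackwardLeraySolutionOn_const_iff {ν : ℝ} {U : E → E} {P : E → ℝ} (hU : ContDiff ℝ ∞ U)
    (hP : ContDiff ℝ ∞ P) :
    IsBackwardLeraySolutionOn univ ν (fun _ : ℝ => U) (fun _ : ℝ => P) ↔ IsLerayProfile ν (1 / 2) U P := by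
  have hD : ∀ s y, timeDerivWithin univ (fun (_ : ℝ) (x : E) => U x) s y = 0 := fun s y => by
    simp only [timeDerivWithin_apply, derivWithin_fun_const, Pi.zero_apply]
  constructor
  · intro h
    refine ⟨hU.of_le (by norm_cast), hP.of_le (by norm_cast), fun y => ?_, h.divFree 0 (mem_univ _)⟩
    have hm := h.momentum_leray (mem_univ 0) y
    rw [hD, zero_add] at hm
    calc -(ν • (Δ U) y) + (1 / 2 : ℝ) • U y + (1 / 2 : ℝ) • fderiv ℝ U y y + convect U U y + gradient P y
        = ((1 / 2 : ℝ) • U y + (1 / 2 : ℝ) • fderiv ℝ U y y + convect U U y + gradient P y)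
            - ν • (Δ U) y := by abel
      _ = 0 := by rw [hm, sub_self]
  · intro h
    refine IsBackwardLeraySolutionOn.of_leray (isSmoothSpaceTimeOn_const_time hU univ)
      (isSmoothSpaceTimeOn_const_time hP univ) (fun s _ y => ?_) fun s _ => h.divFree
    rw [hD, zero_add, ← sub_eq_zero]
    calc (1 / 2 : ℝ) • U y + (1 / 2 : ℝ) • fderiv ℝ U y y + convect U U y + gradient P y - ν • (Δ U) y
        = -(ν • (Δ U) y) + (1 / 2 : ℝ) • U y + (1 / 2 : ℝ) • fderiv ℝ U y y + convect U U y
            + gradient P y := by abel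
      _ = 0 := h.profile_eq y

/-- **Leray's reduction recovered**: for smooth profiles, Leray's backward ansatz with `a = ½`,
`T = 0` is a classical unforced Navier–Stokes solution on `(−∞, 0) × E` iff `(U, P)` is a Leray
profile — the case `a = ½`, `T = 0` of the tree's `lerayBackward_isClassical_iff_holds`, obtained
here through the similarity variables. [cite: Leray1934, §20 (3.11)–(3.12)] -/
theorem isClassicalNSSolutionOn_lerayBackward_half_iff {ν : ℝ} {U : E → E} {P : E → ℝ}
    (hU : ContDiff ℝ ∞ U) (hP : ContDiff ℝ ∞ P) :
    IsClassicalNSSolutionOn (Iio 0) ν 0 (lerayBackward (1 / 2) 0 U) (lerayBackwardPressure (1 / 2) 0 P) ↔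
      IsLerayProfile ν (1 / 2) U P := by
  rw [← ofLerayOrbit_const, ← ofLerayOrbitPressure_const, isClassicalNSSolutionOn_Iio_ofLerayOrbit_iff,
    isBackwardLeraySolutionOn_const_iff hU hP]

end Leray

/-! ### Symmetry dictionary: scaling, (rotated) discrete self-similarity, Type I bounds -/

section Symmetry

variable {E : Type*} [NormedAddCommGroup E] [NormedSpace ℝ E]
variable {F : Type*} [NormedAddCommGroup F] [NormedSpace ℝ F]

/-- **The Navier–Stokes scaling is a time shift of the profile**: for `c > 0`,
`lerayOrbit (nsRescale c u) s = lerayOrbit u (s − 2 log c)` (Chae–Wolf 2017, §4: the discrete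
self-similarity `λu(λx, λ²t) = u(x, t)` "is equivalent to the time periodicity
`U(·, s) = U(·, s + S₀)`, `S₀ := 2 log λ`"). [cite: ChaeWolf2017RemovingDSS, §4 (proof of Thm. 1.5)] -/
theorem lerayOrbit_nsRescale {c : ℝ} (hc : 0 < c) (u : ℝ → E → F) (s : ℝ) :
    lerayOrbit (nsRescale c u) s = lerayOrbit u (s - 2 * Real.log c) := by
  funext y
  simp only [lerayOrbit_apply, nsRescale_apply, smul_smul, exp_neg_sub_two_mul_log_half hc,
    exp_neg_sub_two_mul_log hc, mul_comm (Real.exp (-s / 2)) c, mul_neg]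

/-- **A `λ`-DSS field has a `2 log λ`-periodic profile** (Chae–Wolf 2017, §4). [cite: ChaeWolf2017RemovingDSS, §4 (proof of Thm. 1.5)] -/
theorem IsDiscretelySelfSimilar.periodic_lerayOrbit {c : ℝ} {u : ℝ → E → F} (h : IsDiscretelySelfSimilar c u)
    (hc : 0 < c) : Function.Periodic (lerayOrbit u) (2 * Real.log c) := by
  intro s
  have key := congrArg (fun v : ℝ → E → F => lerayOrbit v (s + 2 * Real.log c)) h
  beta_reduce at key
  rw [lerayOrbit_nsRescale hc, add_sub_cancel_right] at key
  exact key.symm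

/-- **Periodicity of the profile ⇔ discrete self-similarity on the past**: for `c > 0`,
`lerayOrbit u` is `2 log c`-periodic in `s` iff `nsRescale c u t = u t` for all `t < 0` (the
profile only sees the past; Chae–Wolf 2017, §4). [cite: ChaeWolf2017RemovingDSS, §4 (proof of Thm. 1.5)] -/
theorem periodic_lerayOrbit_iff {c : ℝ} (hc : 0 < c) {u : ℝ → E → F} :
    Function.Periodic (lerayOrbit u) (2 * Real.log c) ↔ ∀ t < 0, nsRescale c u t = u t := by
  constructor
  · intro h t ht
    have key : lerayOrbit (nsRescale c u) = lerayOrbit u := by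
      funext s
      rw [lerayOrbit_nsRescale hc, ← h (s - 2 * Real.log c), sub_add_cancel]
    rw [← ofLerayOrbit_lerayOrbit_slice (nsRescale c u) ht, key, ofLerayOrbit_lerayOrbit_slice u ht]
  · intro h s
    rw [show lerayOrbit u s = lerayOrbit (nsRescale c u) (s + 2 * Real.log c) by
      rw [lerayOrbit_nsRescale hc, add_sub_cancel_right]]
    funext y
    rw [lerayOrbit_apply, lerayOrbit_apply, h _ (neg_exp_neg_lt_zero _)]

/-- **A self-similar field has a steady profile**, equal to its slice at `t = −1`:
`lerayOrbit u s = u (−1)` for all `s` (Lemarié-Rieusset 2016, §16.4: "`U(x) = u(−1, x)`"). [cite: LemarieRieusset2016, §16.4 p. 614] -/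
theorem IsSelfSimilar.lerayOrbit_eq {u : ℝ → E → F} (h : IsSelfSimilar u) (s : ℝ) : lerayOrbit u s = u (-1) := by
  funext y
  have key := congrFun (congrFun (h (Real.exp (-s / 2)) (Real.exp_pos _)) (-1)) y
  rw [nsRescale_apply, exp_neg_half_sq, mul_neg_one] at key
  rw [lerayOrbit_apply]
  exact key

/-- The profile of the rotated–rescaled field `(t, x) ↦ c • R⁻¹ u(c²t, c R x)` (`c > 0`, `R` a
linear isometry) is the time-shifted, conjugated profile `(s, y) ↦ R⁻¹ U(s − 2 log c, R y)`. [folklore] -/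
theorem lerayOrbit_rotate_nsRescale {c : ℝ} (hc : 0 < c) (R : E ≃ₗᵢ[ℝ] E) (u : ℝ → E → E) (s : ℝ) (y : E) :
    lerayOrbit (fun t x => c • R.symm (u (c ^ 2 * t) (c • R x))) s y =
      R.symm (lerayOrbit u (s - 2 * Real.log c) (R y)) := by
  simp only [lerayOrbit_apply, exp_neg_sub_two_mul_log_half hc, exp_neg_sub_two_mul_log hc,
    LinearIsometryEquiv.map_smul, smul_smul, mul_comm (Real.exp (-s / 2)) c, mul_neg]

/-- **Twisted periodicity of the profile ⇔ rotated discrete self-similarity on the past**: for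
`c > 0` and a linear isometry `R`, `U(s + 2 log c, y) = R⁻¹ U(s, R y)` for all `s, y` iff
`c • R⁻¹ (u (c²t) (c • R x)) = u t x` for all `t < 0` and `x` (the defining identity of
`IsRotatedDSS c R u`, Chae–Wolf 2017, Def. 1.1 / Bradshaw–Tsai 2017, §1, restricted to the past;
the implication from `IsRotatedDSS c R u` itself is the tree's `IsRotatedDSS.lerayOrbit_add_period`). [cite: BradshawTsai2017CPDE, §1 (rotated discretely self-similar fields)] -/
theorem lerayOrbit_add_eq_symm_iff {c : ℝ} (hc : 0 < c) {R : E ≃ₗᵢ[ℝ] E} {u : ℝ → E → E} :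
    (∀ s y, lerayOrbit u (s + 2 * Real.log c) y = R.symm (lerayOrbit u s (R y))) ↔
      ∀ t < 0, ∀ x, c • R.symm (u (c ^ 2 * t) (c • R x)) = u t x := by
  constructor
  · intro h t ht x
    set v : ℝ → E → E := fun t x => c • R.symm (u (c ^ 2 * t) (c • R x)) with hv
    have key : lerayOrbit v = lerayOrbit u := by
      funext s y
      rw [hv, lerayOrbit_rotate_nsRescale hc, ← h, sub_add_cancel]
    have e1 := congrFun (ofLerayOrbit_lerayOrbit_slice v ht) x
    rw [key, ofLerayOrbit_lerayOrbit_slice u ht] at e1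
    exact e1.symm
  · intro h s y
    have e := lerayOrbit_rotate_nsRescale hc R u (s + 2 * Real.log c) y
    rw [add_sub_cancel_right] at e
    rw [← e, lerayOrbit_apply, lerayOrbit_apply, h _ (neg_exp_neg_lt_zero _)]

/-- **Type I decay in similarity variables**: `‖u(t, x)‖ ≤ C / (‖x‖ + √(−t))` for all `t < 0`, `x`
(`HasTypeIDecay C u`, Koch–Nadirashvili–Seregin–Šverák 2009, (1.6)) iff the profile obeys the
time-independent bound `(1 + ‖y‖) ‖U(s, y)‖ ≤ C` for all `s`, `y` (multiply by `√(−t)` and use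
`‖x‖ = √(−t) ‖y‖`; the forward implication in quotient form is the tree's
`HasTypeIDecay.norm_lerayOrbit_le`). [cite: KNSS2009, (1.6)] -/
theorem hasTypeIDecay_iff_lerayOrbit {C : ℝ} {u : ℝ → E → F} :
    HasTypeIDecay C u ↔ ∀ s y, (1 + ‖y‖) * ‖lerayOrbit u s y‖ ≤ C := by
  constructor
  · intro h s y
    have key := h.norm_lerayOrbit_le s y
    rwa [le_div_iff₀ (by positivity), mul_comm, add_comm] at key
  · intro h t ht x
    have hsq : 0 < Real.sqrt (-t) := Real.sqrt_pos.2 (neg_pos.2 ht)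
    have key := h (-Real.log (-t)) ((Real.sqrt (-t))⁻¹ • x)
    rw [lerayOrbit_neg_log u ht, norm_smul, norm_smul, norm_inv, Real.norm_of_nonneg hsq.le] at key
    have hden : 0 < ‖x‖ + Real.sqrt (-t) := by positivity
    rw [le_div_iff₀ hden]
    calc ‖u t x‖ * (‖x‖ + Real.sqrt (-t))
        = (1 + (Real.sqrt (-t))⁻¹ * ‖x‖) * (Real.sqrt (-t) * ‖u t x‖) := by
          field_simp
          ring
      _ ≤ C := key

/-- A Type I field has a profile decaying like `‖y‖⁻¹`: `‖y‖ ‖U(s, y)‖ ≤ C`, i.e. `|y| |U| ≤ C₀`,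
the form of the bound used in the Gaussian-weighted energy estimates. [cite: KNSS2009, (1.6)] -/
theorem HasTypeIDecay.norm_mul_norm_lerayOrbit_le {C : ℝ} {u : ℝ → E → F} (h : HasTypeIDecay C u) (s : ℝ)
    (y : E) : ‖y‖ * ‖lerayOrbit u s y‖ ≤ C := by
  have key := hasTypeIDecay_iff_lerayOrbit.1 h s y
  have h1 : ‖y‖ * ‖lerayOrbit u s y‖ ≤ (1 + ‖y‖) * ‖lerayOrbit u s y‖ :=
    mul_le_mul_of_nonneg_right (le_add_of_nonneg_left zero_le_one) (norm_nonneg _)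
  exact h1.trans key

/-- A Type I field has a bounded profile: `‖U(s, y)‖ ≤ C`. [cite: KNSS2009, (1.6)] -/
theorem HasTypeIDecay.norm_lerayOrbit_le' {C : ℝ} {u : ℝ → E → F} (h : HasTypeIDecay C u) (s : ℝ) (y : E) :
    ‖lerayOrbit u s y‖ ≤ C := by
  have key := hasTypeIDecay_iff_lerayOrbit.1 h s y
  have h1 : ‖lerayOrbit u s y‖ ≤ (1 + ‖y‖) * ‖lerayOrbit u s y‖ :=
    le_mul_of_one_le_left (norm_nonneg _) (le_add_of_nonneg_right (norm_nonneg _))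
  exact h1.trans key

end Symmetry

end Literature.Analysis.FluidPDE
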